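import Summits.CriticalPhenomena.PercolationContinuityZ3.Theorems.PercNearOneGluingNoHeavyLowerTailThreeSum
import Summits.CriticalPhenomena.PercolationContinuityZ3.Theorems.PercNearOneGluingNoHeavyLowerTailRefinedRowsSepDualRandomCluster
import HarnessLib

/-!
# `NoHeavyLowerTail` (stmt-CriticalPhenomena-4575) — the 3-sum theorem for R1, measure level, part 8:
# cells versus separation atoms, and **R1 ALONE is preserved under 3-sums for `q ≥ 1`**

Support file (prover prim-gen-kcluster gen 71; `--supports stmt-CriticalPhenomena-4575`).  No definitions, no
named facts, no sorries.

Parts 6–7 (`ThreeSum.r1_of_threeSum`, `lb_of_threeSum`, `lg_of_threeSum`) transfer the TRIPLE (R1, LB, LG)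
through a gluing along `{a,b,c}` for every `q > 0`, with the rows written on the three-point CELLS of the
instance `(a; b, c)`.  The tree's `SepDual.r4plus_of_r1_rcMeasureW` (gen 50) gives R4⁺ — hence LB and LG —
from R1 for every `φ_{𝐩,q}` with `q ≥ 1`, but written on the ATO(rcMeasureW u q ∅).real {η : BondConfig V | b ∉ cl η.toFinset a ∧ c ∉ cl η.toFinset a ∧ Sep D (cl η.toFinset a) b c} of the three separation events
`Sep_x = {C(x) meets every path between the other two terminals}`.  This file identifies atoms and cells
almost surely when the support joins the three terminals and concludes:

* `ThreeSum.real_congr_of_support` — two events that agree on configurations inside the support have the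
  same `rcMeasureW`-mass (parameters vanishing off the support).
* `ThreeSum.atoms_iff_cells` — for a configuration `X ⊆ D` with `b, c ∈ cl D a` (the support joins the
  terminals): `Sep_a ∧ Sep_b ∧ Sep_c ↔ abc`, `Sep_a ∧ ¬Sep_b ∧ ¬Sep_c ↔ S`, `Sep_a ∧ Sep_b ∧ ¬Sep_c ↔ ab|c`,
  `Sep_a ∧ ¬Sep_b ∧ Sep_c ↔ ac|b`, `¬Sep_a ∧ Sep_b ∧ Sep_c ↔ a|bc`, and the two atoms `¬Sep_a¬Sep_b¬Sep_c`,
  `¬Sep_a Sep_b ¬Sep_c` lie in `N` (`RefinedRowR3.not_sep_sep`, `ThreeSum.not_sep_of_mem_cl`).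
* `ThreeSum.lb_lg_of_r1_of_joined`, `ThreeSum.lb_lg_of_r1` — for `q ≥ 1`, R1 (cells) ⟹ LB ∧ LG (cells)
  (on a support not joining the terminals `φ(S)·φ(U_a) = 0`).
* **`ThreeSum.r1_of_threeSum_of_r1`** — for `q ≥ 1`: R1 for `φ_A` and R1 for `φ_B` imply R1 for the glued
  measure `φ` — **R1 is closed under 3-sums**, so a minimal counterexample to R1-RC (`q ≥ 1`) has
  `G − {a,b,c}` connected (memo KCLUSTER-gen69 §6 (C3), now kernel).
-/

noncomputable section

namespace Summit.CriticalPhenomena.PercolationContinuityZ3.Theorems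

namespace ThreeSum

open Finset SimpleGraph Literature.Probability.Percolation Literature.Probability.Percolation.Gladkov
open Literature.Probability.Percolation.BHK2006 (weight)
open Literature.Probability.Percolation.DecisionTree (ind ind_of_mem ind_of_not_mem ind_nonneg)
open Literature.Probability.LatticeModels RefinedRowR3 ThreePointLB MeasureTheory
open scoped Classical

variable {V : Type*} [Fintype V]

/-! ### Masses of events that agree on the support -/

section Support

variable (u : Sym2 V → unitInterval) {q : ℝ} (hq : 0 < q) {D : Finset (Sym2 V)}
  (hu : ∀ e, e ∉ (↑D : Set (Sym2 V)) → (u e : ℝ) = 0)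
include hq hu

/-- Two events that agree on the configurations inside the support have the same mass. [folklore] -/
theorem real_congr_of_support {A B : Set (BondConfig V)} (h : ∀ ω : BondConfig V, ω ⊆ ↑D → (ω ∈ A ↔ ω ∈ B)) :
    (rcMeasureW u q ∅).real A = (rcMeasureW u q ∅).real B := by
  rw [rcMeasureW_real_eq_sum_div u hq, rcMeasureW_real_eq_sum_div u hq]
  congr 1
  refine Finset.sum_congr rfl fun ω _ => ?_
  by_cases hω : ω ⊆ ↑D
  · by_cases hA : ω ∈ A
    · rw [ind_of_mem hA, ind_of_mem ((h ω hω).1 hA)]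
    · rw [ind_of_not_mem hA, ind_of_not_mem (fun hB => hA ((h ω hω).2 hB))]
  · unfold rcWeightW; rw [weight_eq_zero_of_not_subset u hu hω]; ring

/-- An event missing every configuration inside the support has mass zero. [folklore] -/
theorem real_eq_zero_of_support {A : Set (BondConfig V)} (h : ∀ ω : BondConfig V, ω ⊆ ↑D → ω ∉ A) :
    (rcMeasureW u q ∅).real A = 0 := by
  rw [real_congr_of_support u hq hu (B := ∅) (fun ω hω => ⟨fun hA => (h ω hω hA).elim, fun h' => h'.elim⟩)]
  exact measureReal_empty

/-- If `A₁, A₂` are disjoint and both inside `B` on the support, then `φ(A₁) + φ(A₂) ≤ φ(B)`. [folklore] -/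
theorem real_add_le_of_support {A₁ A₂ B : Set (BondConfig V)} (hdis : ∀ ω : BondConfig V, ω ∈ A₁ → ω ∉ A₂)
    (h₁ : ∀ ω : BondConfig V, ω ⊆ ↑D → ω ∈ A₁ → ω ∈ B) (h₂ : ∀ ω : BondConfig V, ω ⊆ ↑D → ω ∈ A₂ → ω ∈ B) :
    (rcMeasureW u q ∅).real A₁ + (rcMeasureW u q ∅).real A₂ ≤ (rcMeasureW u q ∅).real B := by
  rw [rcMeasureW_real_eq_sum_div u hq, rcMeasureW_real_eq_sum_div u hq, rcMeasureW_real_eq_sum_div u hq,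
    ← add_div, ← Finset.sum_add_distrib]
  refine div_le_div_of_nonneg_right (Finset.sum_le_sum fun ω _ => ?_) (rcPartitionFunctionW_pos u hq ∅).le
  have hw0 := rcWeightW_nonneg u hq.le ∅ ω
  by_cases hω : ω ⊆ ↑D
  · by_cases hA1 : ω ∈ A₁
    · rw [ind_of_mem hA1, ind_of_not_mem (hdis ω hA1), ind_of_mem (h₁ ω hω hA1)]; linarith
    · by_cases hA2 : ω ∈ A₂
      · rw [ind_of_not_mem hA1, ind_of_mem hA2, ind_of_mem (h₂ ω hω hA2)]; linarith
      · rw [ind_of_not_mem hA1, ind_of_not_mem hA2]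
        nlinarith [ind_nonneg B ω]
  · unfold rcWeightW; rw [weight_eq_zero_of_not_subset u hu hω]; simp

end Support

/-! ### Atoms versus cells on a support joining the terminals -/

section Atoms

variable {D : Finset (Sym2 V)} {a b c : V}

/-- A vertex of `W` is walled off by `W` from any other vertex. [folklore] -/
theorem sep_of_mem_left {W : Finset V} {u v : V} (huv : u ≠ v) (hu : u ∈ W) : Sep D W u v := fun h =>
  huv (reachable_sdiff_touch_a (D := D) hu (mem_cl.1 h)).symm

/-- A vertex of `W` is walled off by `W` from any other vertex (target side). [folklore] -/
theorem sep_of_mem_right {W : Finset V} {u v : V} (huv : u ≠ v) (hv : v ∈ W) : Sep D W u v :=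
  sep_comm.2 (sep_of_mem_left huv.symm hv)

variable (hab : a ≠ b) (hac : a ≠ c) (hbc : b ≠ c) (hDb : b ∈ cl D a) (hDc : c ∈ cl D a)
include hab hac hbc hDb hDc

/-- **Atoms versus cells.**  For a configuration `X ⊆ D` on a support joining `a` to `b` and to `c`, the eight
atoms of `(Sep_a, Sep_b, Sep_c)` are: `abc` (all three), `ab|c` (`Sep_a, Sep_b` only), `ac|b` (`Sep_a, Sep_c`),
`a|bc` (`Sep_b, Sep_c`), and on `a|b|c` at most one separation event holds. [this work] -/
theorem atoms_iff_cells {X : Finset (Sym2 V)} (hX : X ⊆ D) :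
    ((Sep D (cl X a) b c ∧ Sep D (cl X b) a c ∧ Sep D (cl X c) a b) ↔ (b ∈ cl X a ∧ c ∈ cl X a)) ∧
    ((Sep D (cl X a) b c ∧ ¬ Sep D (cl X b) a c ∧ ¬ Sep D (cl X c) a b) ↔
      (b ∉ cl X a ∧ c ∉ cl X a ∧ Sep D (cl X a) b c)) ∧
    ((Sep D (cl X a) b c ∧ Sep D (cl X b) a c ∧ ¬ Sep D (cl X c) a b) ↔ (b ∈ cl X a ∧ c ∉ cl X a)) ∧
    ((Sep D (cl X a) b c ∧ ¬ Sep D (cl X b) a c ∧ Sep D (cl X c) a b) ↔ (b ∉ cl X a ∧ c ∈ cl X a)) ∧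
    ((¬ Sep D (cl X a) b c ∧ Sep D (cl X b) a c ∧ Sep D (cl X c) a b) ↔
      (b ∉ cl X a ∧ c ∉ cl X a ∧ c ∈ cl X b)) := by
  -- elementary facts
  have hca : ∀ {u v : V} {K : Finset (Sym2 V)}, u ∈ cl K v → v ∈ cl K u := fun h => mem_cl_comm.1 h
  -- separation by membership
  have A1 : b ∈ cl X a → Sep D (cl X a) b c := fun h => sep_of_mem_left (D := D) hbc h
  have A2 : c ∈ cl X a → Sep D (cl X a) b c := fun h => sep_of_mem_right (D := D) hbc h
  have B1 : b ∈ cl X a → Sep D (cl X b) a c := fun h => sep_of_mem_left (D := D) hac (hca h)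
  have B2 : c ∈ cl X b → Sep D (cl X b) a c := fun h => sep_of_mem_right (D := D) hac h
  have C1 : c ∈ cl X a → Sep D (cl X c) a b := fun h => sep_of_mem_left (D := D) hab (hca h)
  have C2 : c ∈ cl X b → Sep D (cl X c) a b := fun h => sep_of_mem_right (D := D) hab (hca h)
  -- non-separation by an open path off the cluster
  have nA : b ∉ cl X a → c ∈ cl X b → ¬ Sep D (cl X a) b c := fun hb hcb => not_sep_of_mem_cl hX hb hcb
  have nB : a ∉ cl X b → c ∈ cl X a → ¬ Sep D (cl X b) a c := fun ha hca' =>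
    not_sep_of_mem_cl (a := b) (b := a) (c := c) hX ha hca'
  have nC : a ∉ cl X c → b ∈ cl X a → ¬ Sep D (cl X c) a b := fun ha hab' =>
    not_sep_of_mem_cl (a := c) (b := a) (c := b) hX ha hab'
  -- on `a|b|c` at most one separation (support joins the terminals)
  have hDb' : a ∈ cl D b := hca hDb
  have xAB : b ∉ cl X a → Sep D (cl X a) b c → Sep D (cl X b) a c → False := fun hb h1 h2 =>
    not_sep_sep hX hb hDc h1 h2
  have xAC : c ∉ cl X a → Sep D (cl X a) b c → Sep D (cl X c) a b → False := fun hc h1 h2 =>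
    not_sep_sep hX hc hDb (sep_comm.1 h1) h2
  have xBC : c ∉ cl X b → Sep D (cl X b) a c → Sep D (cl X c) a b → False := fun hc h1 h2 =>
    not_sep_sep hX hc hDb' (sep_comm.1 h1) (sep_comm.1 h2)
  -- transitivity
  have tr1 : b ∈ cl X a → c ∈ cl X a → c ∈ cl X b := fun h h' => mem_cl_trans (hca h) h'
  have tr2 : b ∈ cl X a → c ∈ cl X b → c ∈ cl X a := fun h h' => mem_cl_trans h h'
  have tr3 : c ∈ cl X a → c ∈ cl X b → b ∈ cl X a := fun h h' => mem_cl_trans h (hca h')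
  by_cases hb : b ∈ cl X a <;> by_cases hc : c ∈ cl X a <;> by_cases hcb : c ∈ cl X b
  · exact ⟨⟨fun _ => ⟨hb, hc⟩, fun _ => ⟨A1 hb, B1 hb, C1 hc⟩⟩, ⟨fun h => absurd (B1 hb) h.2.1, fun h => absurd hb h.1⟩,
      ⟨fun h => absurd (C1 hc) h.2.2, fun h => absurd hc h.2⟩, ⟨fun h => absurd (B1 hb) h.2.1, fun h => absurd hb h.1⟩,
      ⟨fun h => absurd (A1 hb) h.1, fun h => absurd hb h.1⟩⟩
  · exact absurd (tr1 hb hc) hcb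
  · exact absurd (tr2 hb hcb) hc
  · have hC : ¬ Sep D (cl X c) a b := nC (fun h => hc (hca h)) hb
    exact ⟨⟨fun h => absurd h.2.2 hC, fun h => absurd h.2 hc⟩, ⟨fun h => absurd (B1 hb) h.2.1, fun h => absurd hb h.1⟩,
      ⟨fun _ => ⟨hb, hc⟩, fun _ => ⟨A1 hb, B1 hb, hC⟩⟩, ⟨fun h => absurd (B1 hb) h.2.1, fun h => absurd hb h.1⟩,
      ⟨fun h => absurd (A1 hb) h.1, fun h => absurd hb h.1⟩⟩
  · exact absurd (tr3 hc hcb) hb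
  · have hB : ¬ Sep D (cl X b) a c := nB (fun h => hb (hca h)) hc
    exact ⟨⟨fun h => absurd h.2.1 hB, fun h => absurd h.1 hb⟩, ⟨fun h => absurd (C1 hc) h.2.2, fun h => absurd hc h.2.1⟩,
      ⟨fun h => absurd (C1 hc) h.2.2, fun h => absurd hc h.2⟩, ⟨fun _ => ⟨hb, hc⟩, fun _ => ⟨A2 hc, hB, C1 hc⟩⟩,
      ⟨fun h => absurd (A2 hc) h.1, fun h => absurd hc h.2.1⟩⟩
  · have hA : ¬ Sep D (cl X a) b c := nA hb hcb
    exact ⟨⟨fun h => absurd h.1 hA, fun h => absurd h.1 hb⟩, ⟨fun h => absurd h.1 hA, fun h => absurd h.2.2 hA⟩,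
      ⟨fun h => absurd h.1 hA, fun h => absurd h.1 hb⟩, ⟨fun h => absurd h.1 hA, fun h => absurd h.2 hc⟩,
      ⟨fun _ => ⟨hb, hc, hcb⟩, fun _ => ⟨hA, B2 hcb, C2 hcb⟩⟩⟩
  · -- pairwise apart: at most one separation
    refine ⟨⟨fun h => (xAB hb h.1 h.2.1).elim, fun h => absurd h.1 hb⟩,
      ⟨fun h => ⟨hb, hc, h.1⟩, fun h => ⟨h.2.2, fun h' => xAB hb h.2.2 h', fun h' => xAC hc h.2.2 h'⟩⟩,
      ⟨fun h => (xAB hb h.1 h.2.1).elim, fun h => absurd h.1 hb⟩,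
      ⟨fun h => (xAC hc h.1 h.2.2).elim, fun h => absurd h.2 hc⟩,
      ⟨fun h => (xBC hcb h.2.1 h.2.2).elim, fun h => absurd h.2.2 hcb⟩⟩

end Atoms

/-! ### LB and LG from R1 (`q ≥ 1`), in cells -/

section Rows

variable {D : Finset (Sym2 V)} {a b c : V} (hab : a ≠ b) (hac : a ≠ c) (hbc : b ≠ c)
  (hDb : b ∈ cl D a) (hDc : c ∈ cl D a)
  (u : Sym2 V → unitInterval) {q : ℝ} (hq : 1 ≤ q) (hu : ∀ e, e ∉ (↑D : Set (Sym2 V)) → (u e : ℝ) = 0)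
include hab hac hbc hDb hDc hq hu

/-- **LB and LG from R1, every `q ≥ 1`, support joining the terminals**, in the cell vocabulary of
`ThreeSum.r1_of_threeSum`: `φ(S)·φ(U_a) ≤ φ(N)·φ(U_b)` and `φ(S)·φ(U_a) ≤ φ(N)·φ(U_c)`.
Proof: `SepDual.r4plus_of_r1_rcMeasureW` (R4⁺ ⟸ R1) for `(a;b,c)` and for `(a;c,b)`, read on the cells by
`atoms_iff_cells`. [this work] -/
theorem lb_lg_of_r1_of_joined
    (hR1 : (rcMeasureW u q ∅).real {η : BondConfig V | b ∈ cl η.toFinset a ∧ c ∈ cl η.toFinset a} * (rcMeasureW u q ∅).real {η : BondConfig V | b ∉ cl η.toFinset a ∧ c ∉ cl η.toFinset a ∧ Sep D (cl η.toFinset a) b c} ≤ (rcMeasureW u q ∅).real {η : BondConfig V | b ∈ cl η.toFinset a ∧ c ∉ cl η.toFinset a} * (rcMeasureW u q ∅).real {η : BondConfig V | b ∉ cl η.toFinset a ∧ c ∈ cl η.toFinset a}) :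
    ((rcMeasureW u q ∅).real {η : BondConfig V | b ∉ cl η.toFinset a ∧ c ∉ cl η.toFinset a ∧ Sep D (cl η.toFinset a) b c} * (rcMeasureW u q ∅).real {η : BondConfig V | b ∉ cl η.toFinset a ∧ c ∉ cl η.toFinset a ∧ c ∈ cl η.toFinset b} ≤ (rcMeasureW u q ∅).real {η : BondConfig V | b ∉ cl η.toFinset a ∧ c ∉ cl η.toFinset a ∧ c ∉ cl η.toFinset b ∧ ¬ Sep D (cl η.toFinset a) b c} * (rcMeasureW u q ∅).real {η : BondConfig V | b ∈ cl η.toFinset a ∧ c ∉ cl η.toFinset a}) ∧ ((rcMeasureW u q ∅).real {η : BondConfig V | b ∉ cl η.toFinset a ∧ c ∉ cl η.toFinset a ∧ Sep D (cl η.toFinset a) b c} * (rcMeasureW u q ∅).real {η : BondConfig V | b ∉ cl η.toFinset a ∧ c ∉ cl η.toFinset a ∧ c ∈ cl η.toFinset b} ≤ (rcMeasureW u q ∅).real {η : BondConfig V | b ∉ cl η.toFinset a ∧ c ∉ cl η.toFinset a ∧ c ∉ cl η.toFinset b ∧ ¬ Sep D (cl η.toFinset a) b c} * (rcMeasureW u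 q ∅).real {η : BondConfig V | b ∉ cl η.toFinset a ∧ c ∈ cl η.toFinset a}) := by
  have hq0 : 0 < q := one_pos.trans_le hq
  -- support facts for configurations inside `D`
  have hsub : ∀ ω : BondConfig V, ω ⊆ ↑D → ω.toFinset ⊆ D := fun ω hω => toFinset_subset_of_subset_coe hω
  have key := fun (ω : BondConfig V) (hω : ω ⊆ ↑D) => atoms_iff_cells hab hac hbc hDb hDc (hsub ω hω)
  have hDc' : b ∈ cl D a := hDb
  have keyc := fun (ω : BondConfig V) (hω : ω ⊆ ↑D) => atoms_iff_cells hac hab hbc.symm hDc hDb (hsub ω hω)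
  -- identification of the four R1 cells with atoms, for `(a;b,c)` and for `(a;c,b)`
  have eT : (rcMeasureW u q ∅).real {η : BondConfig V | b ∈ cl η.toFinset a ∧ c ∈ cl η.toFinset a} = (rcMeasureW u q ∅).real {ω : BondConfig V | Sep D (cl ω.toFinset a) b c ∧ Sep D (cl ω.toFinset b) a c ∧ Sep D (cl ω.toFinset c) a b} := real_congr_of_support u hq0 hu fun ω hω => ((key ω hω).1).symm
  have eS : (rcMeasureW u q ∅).real {η : BondConfig V | b ∉ cl η.toFinset a ∧ c ∉ cl η.toFinset a ∧ Sep D (cl η.toFinset a) b c} = (rcMeasureW u q ∅).real {ω : BondConfig V | Sep D (cl ω.toFinset a) b c ∧ ¬ Sep D (cl ω.toFinset b) a c ∧ ¬ Sep D (cl ω.toFinset c) a b} := real_congr_of_support u hq0 hu fun ω hω => ((key ω hω).2.1).symm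
  have eUb : (rcMeasureW u q ∅).real {η : BondConfig V | b ∈ cl η.toFinset a ∧ c ∉ cl η.toFinset a} = (rcMeasureW u q ∅).real {ω : BondConfig V | Sep D (cl ω.toFinset a) b c ∧ Sep D (cl ω.toFinset b) a c ∧ ¬ Sep D (cl ω.toFinset c) a b} := real_congr_of_support u hq0 hu fun ω hω => ((key ω hω).2.2.1).symm
  have eUc : (rcMeasureW u q ∅).real {η : BondConfig V | b ∉ cl η.toFinset a ∧ c ∈ cl η.toFinset a} = (rcMeasureW u q ∅).real {ω : BondConfig V | Sep D (cl ω.toFinset a) b c ∧ ¬ Sep D (cl ω.toFinset b) a c ∧ Sep D (cl ω.toFinset c) a b} := real_congr_of_support u hq0 hu fun ω hω => ((key ω hω).2.2.2.1).symm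
  have eN : (rcMeasureW u q ∅).real {η : BondConfig V | b ∉ cl η.toFinset a ∧ c ∉ cl η.toFinset a ∧ c ∈ cl η.toFinset b} = (rcMeasureW u q ∅).real {ω : BondConfig V | ¬ Sep D (cl ω.toFinset a) b c ∧ Sep D (cl ω.toFinset b) a c ∧ Sep D (cl ω.toFinset c) a b} := real_congr_of_support u hq0 hu fun ω hω => ((key ω hω).2.2.2.2).symm
  -- the same atoms with `b` and `c` exchanged
  have eTc : (rcMeasureW u q ∅).real {η : BondConfig V | b ∈ cl η.toFinset a ∧ c ∈ cl η.toFinset a} = (rcMeasureW u q ∅).real {ω : BondConfig V | Sep D (cl ω.toFinset a) c b ∧ Sep D (cl ω.toFinset c) a b ∧ Sep D (cl ω.toFinset b) a c} := real_congr_of_support u hq0 hu fun ω hω => by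
    rw [Set.mem_setOf_eq, Set.mem_setOf_eq, (keyc ω hω).1]; exact and_comm
  have eSc : (rcMeasureW u q ∅).real {η : BondConfig V | b ∉ cl η.toFinset a ∧ c ∉ cl η.toFinset a ∧ Sep D (cl η.toFinset a) b c} = (rcMeasureW u q ∅).real {ω : BondConfig V | Sep D (cl ω.toFinset a) c b ∧ ¬ Sep D (cl ω.toFinset c) a b ∧ ¬ Sep D (cl ω.toFinset b) a c} := real_congr_of_support u hq0 hu fun ω hω => by
    rw [Set.mem_setOf_eq, Set.mem_setOf_eq, (keyc ω hω).2.1, sep_comm]; tauto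
  have eUbc : (rcMeasureW u q ∅).real {η : BondConfig V | b ∈ cl η.toFinset a ∧ c ∉ cl η.toFinset a} = (rcMeasureW u q ∅).real {ω : BondConfig V | Sep D (cl ω.toFinset a) c b ∧ ¬ Sep D (cl ω.toFinset c) a b ∧ Sep D (cl ω.toFinset b) a c} := real_congr_of_support u hq0 hu fun ω hω => by
    rw [Set.mem_setOf_eq, Set.mem_setOf_eq, (keyc ω hω).2.2.2.1]; exact and_comm
  have eUcc : (rcMeasureW u q ∅).real {η : BondConfig V | b ∉ cl η.toFinset a ∧ c ∈ cl η.toFinset a} = (rcMeasureW u q ∅).real {ω : BondConfig V | Sep D (cl ω.toFinset a) c b ∧ Sep D (cl ω.toFinset c) a b ∧ ¬ Sep D (cl ω.toFinset b) a c} := real_congr_of_support u hq0 hu fun ω hω => by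
    rw [Set.mem_setOf_eq, Set.mem_setOf_eq, (keyc ω hω).2.2.1]; exact and_comm
  have eNc : (rcMeasureW u q ∅).real {η : BondConfig V | b ∉ cl η.toFinset a ∧ c ∉ cl η.toFinset a ∧ c ∈ cl η.toFinset b} = (rcMeasureW u q ∅).real {ω : BondConfig V | ¬ Sep D (cl ω.toFinset a) c b ∧ Sep D (cl ω.toFinset c) a b ∧ Sep D (cl ω.toFinset b) a c} := real_congr_of_support u hq0 hu fun ω hω => by
    rw [Set.mem_setOf_eq, Set.mem_setOf_eq, (keyc ω hω).2.2.2.2, mem_cl_comm (x := c) (v := b)]; tauto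
  -- the two remaining atoms lie in `N`
  have leN : (rcMeasureW u q ∅).real {ω : BondConfig V | ¬ Sep D (cl ω.toFinset a) b c ∧ ¬ Sep D (cl ω.toFinset b) a c ∧ ¬ Sep D (cl ω.toFinset c) a b} + (rcMeasureW u q ∅).real {ω : BondConfig V | ¬ Sep D (cl ω.toFinset a) b c ∧ Sep D (cl ω.toFinset b) a c ∧ ¬ Sep D (cl ω.toFinset c) a b} ≤ (rcMeasureW u q ∅).real {η : BondConfig V | b ∉ cl η.toFinset a ∧ c ∉ cl η.toFinset a ∧ c ∉ cl η.toFinset b ∧ ¬ Sep D (cl η.toFinset a) b c} := by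
    refine real_add_le_of_support u hq0 hu (fun ω h h' => h.2.1 h'.2.1) (fun ω hω h => ?_) (fun ω hω h => ?_)
    · have k := key ω hω
      by_cases hb : b ∈ cl ω.toFinset a
      · exact absurd (sep_of_mem_left (D := D) hbc hb) h.1
      by_cases hc : c ∈ cl ω.toFinset a
      · exact absurd (sep_of_mem_right (D := D) hbc hc) h.1
      by_cases hcb : c ∈ cl ω.toFinset b
      · exact absurd (k.2.2.2.2.2 ⟨hb, hc, hcb⟩).2.1 h.2.1
      exact ⟨hb, hc, hcb, h.1⟩
    · have k := key ω hω
      by_cases hb : b ∈ cl ω.toFinset a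
      · exact absurd (sep_of_mem_left (D := D) hbc hb) h.1
      by_cases hc : c ∈ cl ω.toFinset a
      · exact absurd (sep_of_mem_right (D := D) hbc hc) h.1
      by_cases hcb : c ∈ cl ω.toFinset b
      · exact absurd (k.2.2.2.2.2 ⟨hb, hc, hcb⟩).2.2 h.2.2
      exact ⟨hb, hc, hcb, h.1⟩
  have leNc : (rcMeasureW u q ∅).real {ω : BondConfig V | ¬ Sep D (cl ω.toFinset a) c b ∧ ¬ Sep D (cl ω.toFinset c) a b ∧ ¬ Sep D (cl ω.toFinset b) a c} + (rcMeasureW u q ∅).real {ω : BondConfig V | ¬ Sep D (cl ω.toFinset a) c b ∧ Sep D (cl ω.toFinset c) a b ∧ ¬ Sep D (cl ω.toFinset b) a c} ≤ (rcMeasureW u q ∅).real {η : BondConfig V | b ∉ cl η.toFinset a ∧ c ∉ cl η.toFinset a ∧ c ∉ cl η.toFinset b ∧ ¬ Sep D (cl η.toFinset a) b c} := by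
    refine real_add_le_of_support u hq0 hu (fun ω h h' => h.2.1 h'.2.1) (fun ω hω h => ?_) (fun ω hω h => ?_)
    · have k := keyc ω hω
      by_cases hc : c ∈ cl ω.toFinset a
      · exact absurd (sep_of_mem_left (D := D) hbc.symm hc) h.1
      by_cases hb : b ∈ cl ω.toFinset a
      · exact absurd (sep_of_mem_right (D := D) hbc.symm hb) h.1
      by_cases hbc' : b ∈ cl ω.toFinset c
      · exact absurd (k.2.2.2.2.2 ⟨hc, hb, hbc'⟩).2.1 h.2.1
      exact ⟨hb, hc, fun h' => hbc' (mem_cl_comm.1 h'), fun h' => h.1 (sep_comm.1 h')⟩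
    · have k := keyc ω hω
      by_cases hc : c ∈ cl ω.toFinset a
      · exact absurd (sep_of_mem_left (D := D) hbc.symm hc) h.1
      by_cases hb : b ∈ cl ω.toFinset a
      · exact absurd (sep_of_mem_right (D := D) hbc.symm hb) h.1
      by_cases hbc' : b ∈ cl ω.toFinset c
      · exact absurd (k.2.2.2.2.2 ⟨hc, hb, hbc'⟩).2.2 h.2.2
      exact ⟨hb, hc, fun h' => hbc' (mem_cl_comm.1 h'), fun h' => h.1 (sep_comm.1 h')⟩
  -- R4⁺ for `(a;b,c)` gives LG, R4⁺ for `(a;c,b)` gives LB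
  have r4 := SepDual.r4plus_of_r1_rcMeasureW D u hq a b c (by rw [← eT, ← eS, ← eUc, ← eUb]; linarith [hR1])
  have r4c := SepDual.r4plus_of_r1_rcMeasureW D u hq a c b (by rw [← eTc, ← eSc, ← eUbc, ← eUcc]; linarith [hR1])
  rw [← eS, ← eN, ← eUc] at r4
  rw [← eSc, ← eNc, ← eUbc] at r4c
  have hSn : 0 ≤ (rcMeasureW u q ∅).real {η : BondConfig V | b ∉ cl η.toFinset a ∧ c ∉ cl η.toFinset a ∧ Sep D (cl η.toFinset a) b c} := measureReal_nonneg
  have hUbn : 0 ≤ (rcMeasureW u q ∅).real {η : BondConfig V | b ∈ cl η.toFinset a ∧ c ∉ cl η.toFinset a} := measureReal_nonneg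
  have hUcn : 0 ≤ (rcMeasureW u q ∅).real {η : BondConfig V | b ∉ cl η.toFinset a ∧ c ∈ cl η.toFinset a} := measureReal_nonneg
  constructor
  · calc (rcMeasureW u q ∅).real {η : BondConfig V | b ∉ cl η.toFinset a ∧ c ∉ cl η.toFinset a ∧ Sep D (cl η.toFinset a) b c} * (rcMeasureW u q ∅).real {η : BondConfig V | b ∉ cl η.toFinset a ∧ c ∉ cl η.toFinset a ∧ c ∈ cl η.toFinset b} ≤ (rcMeasureW u q ∅).real {η : BondConfig V | b ∉ cl η.toFinset a ∧ c ∉ cl η.toFinset a ∧ Sep D (cl η.toFinset a) b c} * ((rcMeasureW u q ∅).real {η : BondConfig V | b ∉ cl η.toFinset a ∧ c ∉ cl η.toFinset a ∧ c ∈ cl η.toFinset b} + (rcMeasureW u q ∅).real {ω : BondConfig V | ¬ Sep D (cl ω.toFinset a) c b ∧ ¬ Sep D (cl ω.toFinset c) a b ∧ Sep D (cl ω.toFinset b) a c}) :=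
          mul_le_mul_of_nonneg_left (le_add_of_nonneg_right measureReal_nonneg) hSn
      _ ≤ (rcMeasureW u q ∅).real {η : BondConfig V | b ∈ cl η.toFinset a ∧ c ∉ cl η.toFinset a} * ((rcMeasureW u q ∅).real {ω : BondConfig V | ¬ Sep D (cl ω.toFinset a) c b ∧ ¬ Sep D (cl ω.toFinset c) a b ∧ ¬ Sep D (cl ω.toFinset b) a c} + (rcMeasureW u q ∅).real {ω : BondConfig V | ¬ Sep D (cl ω.toFinset a) c b ∧ Sep D (cl ω.toFinset c) a b ∧ ¬ Sep D (cl ω.toFinset b) a c}) := r4c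
      _ ≤ (rcMeasureW u q ∅).real {η : BondConfig V | b ∈ cl η.toFinset a ∧ c ∉ cl η.toFinset a} * (rcMeasureW u q ∅).real {η : BondConfig V | b ∉ cl η.toFinset a ∧ c ∉ cl η.toFinset a ∧ c ∉ cl η.toFinset b ∧ ¬ Sep D (cl η.toFinset a) b c} := mul_le_mul_of_nonneg_left leNc hUbn
      _ = (rcMeasureW u q ∅).real {η : BondConfig V | b ∉ cl η.toFinset a ∧ c ∉ cl η.toFinset a ∧ c ∉ cl η.toFinset b ∧ ¬ Sep D (cl η.toFinset a) b c} * (rcMeasureW u q ∅).real {η : BondConfig V | b ∈ cl η.toFinset a ∧ c ∉ cl η.toFinset a} := mul_comm _ _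
  · calc (rcMeasureW u q ∅).real {η : BondConfig V | b ∉ cl η.toFinset a ∧ c ∉ cl η.toFinset a ∧ Sep D (cl η.toFinset a) b c} * (rcMeasureW u q ∅).real {η : BondConfig V | b ∉ cl η.toFinset a ∧ c ∉ cl η.toFinset a ∧ c ∈ cl η.toFinset b} ≤ (rcMeasureW u q ∅).real {η : BondConfig V | b ∉ cl η.toFinset a ∧ c ∉ cl η.toFinset a ∧ Sep D (cl η.toFinset a) b c} * ((rcMeasureW u q ∅).real {η : BondConfig V | b ∉ cl η.toFinset a ∧ c ∉ cl η.toFinset a ∧ c ∈ cl η.toFinset b} + (rcMeasureW u q ∅).real {ω : BondConfig V | ¬ Sep D (cl ω.toFinset a) b c ∧ ¬ Sep D (cl ω.toFinset b) a c ∧ Sep D (cl ω.toFinset c) a b}) :=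
          mul_le_mul_of_nonneg_left (le_add_of_nonneg_right measureReal_nonneg) hSn
      _ ≤ (rcMeasureW u q ∅).real {η : BondConfig V | b ∉ cl η.toFinset a ∧ c ∈ cl η.toFinset a} * ((rcMeasureW u q ∅).real {ω : BondConfig V | ¬ Sep D (cl ω.toFinset a) b c ∧ ¬ Sep D (cl ω.toFinset b) a c ∧ ¬ Sep D (cl ω.toFinset c) a b} + (rcMeasureW u q ∅).real {ω : BondConfig V | ¬ Sep D (cl ω.toFinset a) b c ∧ Sep D (cl ω.toFinset b) a c ∧ ¬ Sep D (cl ω.toFinset c) a b}) := r4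
      _ ≤ (rcMeasureW u q ∅).real {η : BondConfig V | b ∉ cl η.toFinset a ∧ c ∈ cl η.toFinset a} * (rcMeasureW u q ∅).real {η : BondConfig V | b ∉ cl η.toFinset a ∧ c ∉ cl η.toFinset a ∧ c ∉ cl η.toFinset b ∧ ¬ Sep D (cl η.toFinset a) b c} := mul_le_mul_of_nonneg_left leN hUcn
      _ = (rcMeasureW u q ∅).real {η : BondConfig V | b ∉ cl η.toFinset a ∧ c ∉ cl η.toFinset a ∧ c ∉ cl η.toFinset b ∧ ¬ Sep D (cl η.toFinset a) b c} * (rcMeasureW u q ∅).real {η : BondConfig V | b ∉ cl η.toFinset a ∧ c ∈ cl η.toFinset a} := mul_comm _ _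

end Rows

/-! ### LB and LG from R1 (`q ≥ 1`): general supports -/

section RowsGeneral

variable {D : Finset (Sym2 V)} {a b c : V} (hab : a ≠ b) (hac : a ≠ c) (hbc : b ≠ c)
  (u : Sym2 V → unitInterval) {q : ℝ} (hq : 1 ≤ q) (hu : ∀ e, e ∉ (↑D : Set (Sym2 V)) → (u e : ℝ) = 0)
include hab hac hbc hq hu

/-- **LB and LG from R1, every `q ≥ 1`, any support**: if the support does not join the terminals then
`φ(S)·φ(U_a) = 0` (either no configuration separates, or none joins `b` to `c`), so LB and LG are trivial;
otherwise `lb_lg_of_r1_of_joined`. [this work] -/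
theorem lb_lg_of_r1
    (hR1 : (rcMeasureW u q ∅).real {η : BondConfig V | b ∈ cl η.toFinset a ∧ c ∈ cl η.toFinset a} * (rcMeasureW u q ∅).real {η : BondConfig V | b ∉ cl η.toFinset a ∧ c ∉ cl η.toFinset a ∧ Sep D (cl η.toFinset a) b c} ≤ (rcMeasureW u q ∅).real {η : BondConfig V | b ∈ cl η.toFinset a ∧ c ∉ cl η.toFinset a} * (rcMeasureW u q ∅).real {η : BondConfig V | b ∉ cl η.toFinset a ∧ c ∈ cl η.toFinset a}) :
    ((rcMeasureW u q ∅).real {η : BondConfig V | b ∉ cl η.toFinset a ∧ c ∉ cl η.toFinset a ∧ Sep D (cl η.toFinset a) b c} * (rcMeasureW u q ∅).real {η : BondConfig V | b ∉ cl η.toFinset a ∧ c ∉ cl η.toFinset a ∧ c ∈ cl η.toFinset b} ≤ (rcMeasureW u q ∅).real {η : BondConfig V | b ∉ cl η.toFinset a ∧ c ∉ cl η.toFinset a ∧ c ∉ cl η.toFinset b ∧ ¬ Sep D (cl η.toFinset a) b c} * (rcMeasureW u q ∅).real {η : BondConfig V | b ∈ cl η.toFinset a ∧ c ∉ cl η.toFinset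 a}) ∧ ((rcMeasureW u q ∅).real {η : BondConfig V | b ∉ cl η.toFinset a ∧ c ∉ cl η.toFinset a ∧ Sep D (cl η.toFinset a) b c} * (rcMeasureW u q ∅).real {η : BondConfig V | b ∉ cl η.toFinset a ∧ c ∉ cl η.toFinset a ∧ c ∈ cl η.toFinset b} ≤ (rcMeasureW u q ∅).real {η : BondConfig V | b ∉ cl η.toFinset a ∧ c ∉ cl η.toFinset a ∧ c ∉ cl η.toFinset b ∧ ¬ Sep D (cl η.toFinset a) b c} * (rcMeasureW u q ∅).real {η : BondConfig V | b ∉ cl η.toFinset a ∧ c ∈ cl η.toFinset a}) := by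
  have hq0 : 0 < q := one_pos.trans_le hq
  by_cases hcb : c ∈ cl D b
  · by_cases hb : b ∈ cl D a
    · exact lb_lg_of_r1_of_joined hab hac hbc hb (mem_cl_trans hb hcb) u hq hu hR1
    · -- `b ~ c` in `D` but `a ≁ b`: no configuration inside `D` separates `b` from `c` by `C(a)`
      have hS : (rcMeasureW u q ∅).real {η : BondConfig V | b ∉ cl η.toFinset a ∧ c ∉ cl η.toFinset a ∧ Sep D (cl η.toFinset a) b c} = 0 := by
        refine real_eq_zero_of_support u hq0 hu fun ω hω hωS => hωS.2.2 ?_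
        have hsub : ω.toFinset ⊆ D := toFinset_subset_of_subset_coe hω
        have hW : ∀ v ∈ cl D b, v ∉ cl ω.toFinset a := fun v hv hva =>
          hb (mem_cl_trans (cl_mono hsub a hva) (mem_cl_comm.1 hv))
        exact cl_subset_cl_sdiff_touch (subset_refl D) hW hcb
      rw [hS, zero_mul]
      exact ⟨mul_nonneg measureReal_nonneg measureReal_nonneg, mul_nonneg measureReal_nonneg measureReal_nonneg⟩
  · -- `b ≁ c` in `D`: no configuration inside `D` joins `b` to `c`
    have hUa : (rcMeasureW u q ∅).real {η : BondConfig V | b ∉ cl η.toFinset a ∧ c ∉ cl η.toFinset a ∧ c ∈ cl η.toFinset b} = 0 := by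
      refine real_eq_zero_of_support u hq0 hu fun ω hω hωU => hcb ?_
      exact cl_mono (toFinset_subset_of_subset_coe hω) b hωU.2.2
    rw [hUa, mul_zero]
    exact ⟨mul_nonneg measureReal_nonneg measureReal_nonneg, mul_nonneg measureReal_nonneg measureReal_nonneg⟩

end RowsGeneral

/-! ### R1 alone is preserved under 3-sums for `q ≥ 1` -/

section Corollary

variable {DA DB D : Finset (Sym2 V)} {a b c : V} (hab : a ≠ b) (hac : a ≠ c) (hbc : b ≠ c)
  (hsepD : ∀ v : V, (∃ e ∈ DA, v ∈ e) → (∃ e ∈ DB, v ∈ e) → (v = a ∨ v = b ∨ v = c))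
  (hD : ∀ e, e ∈ D ↔ e ∈ DA ∨ e ∈ DB)
  (w wA wB : Sym2 V → unitInterval) {q : ℝ} (hq : 1 ≤ q)
  (hw : ∀ e, e ∉ (↑DA ∪ ↑DB : Set (Sym2 V)) → (w e : ℝ) = 0)
  (hA : ∀ e ∈ (↑DA : Set (Sym2 V)), wA e = w e) (hA' : ∀ e ∉ (↑DA : Set (Sym2 V)), wA e = 0)
  (hB : ∀ e ∈ (↑DA : Set (Sym2 V)), wB e = 0) (hB' : ∀ e ∉ (↑DA : Set (Sym2 V)), wB e = w e)
include hab hac hbc hsepD hD hq hw hA hA' hB hB'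

/-- **R1 is closed under 3-sums (`q ≥ 1`).**  Let the supports `DA`, `DB` of the two pieces meet only in
`{a,b,c}`.  If the free random-cluster measures of both pieces satisfy R1 (`φ(T)·φ(S) ≤ φ(U_b)·φ(U_c)` for the
instance `(a; b, c)`), then so does the free random-cluster measure of the glued graph (`r1_of_threeSum` +
`lb_lg_of_r1`).  Hence a minimal counterexample to R1-RC (`q ≥ 1`) has `G − {a,b,c}` connected
(KCLUSTER-gen69 §6 (C3), now kernel). [this work] -/
theorem r1_of_threeSum_of_r1
    (hR1A : (rcMeasureW wA q ∅).real {η : BondConfig V | b ∈ cl η.toFinset a ∧ c ∈ cl η.toFinset a} * (rcMeasureW wA q ∅).real {η : BondConfig V | b ∉ cl η.toFinset a ∧ c ∉ cl η.toFinset a ∧ Sep DA (cl η.toFinset a) b c} ≤ (rcMeasureW wA q ∅).real {η : BondConfig V | b ∈ cl η.toFinset a ∧ c ∉ cl η.toFinset a} * (rcMeasureW wA q ∅).real {η : BondConfig V | b ∉ cl η.toFinset a ∧ c ∈ cl η.toFinset a})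
    (hR1B : (rcMeasureW wB q ∅).real {η : BondConfig V | b ∈ cl η.toFinset a ∧ c ∈ cl η.toFinset a} * (rcMeasureW wB q ∅).real {η : BondConfig V | b ∉ cl η.toFinset a ∧ c ∉ cl η.toFinset a ∧ Sep DB (cl η.toFinset a) b c} ≤ (rcMeasureW wB q ∅).real {η : BondConfig V | b ∈ cl η.toFinset a ∧ c ∉ cl η.toFinset a} * (rcMeasureW wB q ∅).real {η : BondConfig V | b ∉ cl η.toFinset a ∧ c ∈ cl η.toFinset a}) :
    (rcMeasureW w q ∅).real {η : BondConfig V | b ∈ cl η.toFinset a ∧ c ∈ cl η.toFinset a} * (rcMeasureW w q ∅).real {η : BondConfig V | b ∉ cl η.toFinset a ∧ c ∉ cl η.toFinset a ∧ Sep D (cl η.toFinset a) b c} ≤ (rcMeasureW w q ∅).real {η : BondConfig V | b ∈ cl η.toFinset a ∧ c ∉ cl η.toFinset a} * (rcMeasureW w q ∅).real {η : BondConfig V | b ∉ cl η.toFinset a ∧ c ∈ cl η.toFinset a} := by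
  have hq0 : 0 < q := one_pos.trans_le hq
  have hwA : ∀ e, e ∉ (↑DA : Set (Sym2 V)) → (wA e : ℝ) = 0 := fun e he => by rw [hA' e he]; rfl
  have hwB : ∀ e, e ∉ (↑DB : Set (Sym2 V)) → (wB e : ℝ) = 0 := by
    intro e he
    by_cases heA : e ∈ (↑DA : Set (Sym2 V))
    · rw [hB e heA]; rfl
    · rw [hB' e heA]; exact hw e (fun h => h.elim heA he)
  obtain ⟨lbA, lgA⟩ := lb_lg_of_r1 hab hac hbc wA hq hwA hR1A
  obtain ⟨lbB, lgB⟩ := lb_lg_of_r1 hab hac hbc wB hq hwB hR1B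
  exact r1_of_threeSum hab hac hbc hsepD hD w wA wB hq0 hw hA hA' hB hB' hR1A lbA lgA hR1B lbB lgB

end Corollary

end ThreeSum

end Summit.CriticalPhenomena.PercolationContinuityZ3.Theorems
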